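import Summits.BirchSwinnertonDyer.BirchSwinnertonDyer.Theorems.EisensteinPrimesResidualDevissageNonsplitLambdaIdentityOfFacts
import Summits.BirchSwinnertonDyer.BirchSwinnertonDyer.Theorems.EisensteinPrimesResidualLineRigidity
import HarnessLib

/-!
# At a NON-SPLIT multiplicative Eisenstein prime EVERY `Γ_K`-stable line of `E_K[p]` has both characters `∉ {𝟙, ω}` at `v̄`;
# hence Keller–Yin Thm. 1.4.1's λ-relation for EVERY residual pair of `E_K[p]` modulo CGLS22 Prop. 1.2.5 + Cor. 1.2.6 [PUB] only
# (cell `bsd-eis`, seat `bsd-line-x2-p2` gen 6, D-0154 KEY row 5; crux 4 `BSDpOnCellC` stmt-BirchSwinnertonDyer-19034, line b1; sequel of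
# `…ResidualDevissageNonsplitLambdaIdentityOfFacts`)

HONEST FRAMING (cell `bsd-eis`, run/shared/lean/pub/bsd-eis/): bookkeeping on constructed objects; no definition, no named fact,
no `sorry`, no `Theses` import; nothing about BSD or a main conjecture is asserted; nothing booked; no label or count moves. Helper
`--supports stmt-BirchSwinnertonDyer-19034`; closes no stub. CONDITIONAL on the three PUBLISHED CGLS22 §1.2 named facts
(`prop125_characterGrSelmerDual_torsion_muZero_dim`, `cor126_residualCharacter_globalLift`, `cor126_residualCharacter_localSurjective`).

* §1 `not_fix_and_not_quot_of_not_split_of_card_eq` — for `W/ℚ` with NON-split multiplicative reduction at an odd `p` and ANY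
  subgroup `Φ ≤ E[p](ℚ̄)` of order `p` (no rationality / stability assumed), at EVERY prime `𝔓 ∣ p` of `\bar ℤ`: `D_𝔓` does not fix
  `Φ` pointwise and does not act trivially on `E[p]/Φ` (g4's `not_fix_and_not_quot_of_not_split_of_mem_primesAbove` had `Φ` rational;
  the underlying Tate-curve lemma `X2.TateLineDecomposition.not_fix_and_not_quot_of_not_split` needs only `#Φ = p` at the chosen prime,
  and `𝔓 = σ𝔓₀` is handled by applying it to the line `σ⁻¹Φ`).
* §2 `localData_of_not_split` — hence for `K` imaginary quadratic with `(p)` split, `v̄ ∋ p`, ANY `ℤ_p`-extension `κ` and ANY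
  `Γ_K`-stable `S ≤ E_K[p]` of order `p`: `#(E_K[p]/S) = p`, `D_{v̄}` fixes neither `S` nor `E_K[p]/S` pointwise and acts on neither
  through `ω`, and `E_K[p]/S` has no `(ker κ ⊓ D_{v̄})`-fixed vector (CHL transport lemmas with the line `t⁻¹(S)`).
* §3 **`lambdaInvariant_le_add_of_isResidualPairOver_of_not_split`** — at every NON-SPLIT multiplicative Eisenstein datum of
  Keller–Yin Lemma 5.1.1 (`W/ℚ` globally minimal, `2 < p`, `p ‖ N` non-split, `K` imaginary quadratic Heegner for `N_E`, `(p)` split,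
  `v̄ ∋ p`, `κ` anticyclotomic with generator `γ`, `Sf` = places over `N_E` off `p`) and EVERY residual pair `(θsub, θquot)` of `E_K[p]`
  (`IsResidualPairOver`): for all strict dual data `Dsub`, `Dquot`,
  **`p^{λ(𝔛^{Sf}_f)} · #𝔛^{Sf}_f[p] = p^{λ(Dsub.X) + λ(Dquot.X)}`, `λ(𝔛^{Sf}_f) ≤ λ(Dsub.X) + λ(Dquot.X)`, `=` if `𝔛^{Sf}_f[p] = 0`** —
  NO local hypothesis left; modulo CGLS22 Prop. 1.2.5 + Cor. 1.2.6 [PUB] by name.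

References: [CastellaGrossiLeeSkinner2022] §1.2 Prop. 1.2.5, Cor. 1.2.6, §1.4 Props. 1.4.1–1.4.2, Cor. 1.4.3 (e-print TeX L681–905);
[KellerYin2024] Thm. 1.4.1, Lemma 5.1.1, §5.1 (arXiv:2402.12781v2); [SilvermanATAEC1994] Ch. V Thm. 5.3, Cor. 5.4; [NeukirchANT1999] I §9;
cell p626493 (g4), `…LineBaseChange` / `…TowerFixed` / `…LineDeterminant` (CHL), `…ResidualLineRigidity` (x1-p1-w2), p639968–p643997 (this seat).
-/

set_option autoImplicit false
set_option linter.dupNamespace false -- the summit namespace `…BirchSwinnertonDyer.BirchSwinnertonDyer.Theorems` (Sub = Summit, D-0017) trips it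

noncomputable section

open scoped Classical Pointwise

namespace Summit.BirchSwinnertonDyer.BirchSwinnertonDyer.Theorems.ResidualDevissageNonsplitLambdaIdentityAtNonsplit

open WeierstrassCurve NumberField IsDedekindDomain Field
  Literature.NumberTheory.EllipticCurves Literature.NumberTheory.EllipticCurves.IwasawaAlgebra
  Literature.NumberTheory.EllipticCurves.GreenbergSelmer
  Literature.NumberTheory.EllipticCurves.GreenbergVatsal2000
  Literature.NumberTheory.GaloisRepresentations IsDedekindDomain.HeightOneSpectrum
  Literature.NumberTheory.EllipticCurves.Rank1Residual Literature.NumberTheory.EllipticCurves.KellerYin2024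
  Summit.BirchSwinnertonDyer.Rank1Residual.X11b Summit.BirchSwinnertonDyer.Rank1Residual.X11b.AcSelmer
  Summit.BirchSwinnertonDyer.Rank1Residual.X2.ResidualDevissageModules
  Summit.BirchSwinnertonDyer.BirchSwinnertonDyer.Theorems
  Summit.BirchSwinnertonDyer.BirchSwinnertonDyer.Theorems.ResidualDevissageNonsplitLocalData
  Summit.BirchSwinnertonDyer.BirchSwinnertonDyer.Theorems.ResidualDevissageNonsplitLambdaIdentityOfFacts
  Summit.BirchSwinnertonDyer.BirchSwinnertonDyer.Theorems.CumulativeHeegnerInclusionAtThreeResidualDevissage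
  Summit.BirchSwinnertonDyer.BirchSwinnertonDyer.Theorems.CumulativeHeegnerInclusionAtThreeLineBaseChange
  Summit.BirchSwinnertonDyer.BirchSwinnertonDyer.Theorems.CumulativeHeegnerInclusionAtThreeTowerFixed
  Summit.BirchSwinnertonDyer.BirchSwinnertonDyer.Theorems.CumulativeHeegnerInclusionAtThreeStubB1LineDeterminant
  Summit.BirchSwinnertonDyer.BirchSwinnertonDyer.Theorems.CumulativeHeegnerInclusionAtThreeBadPlaces
  Summit.BirchSwinnertonDyer.BirchSwinnertonDyer.Theorems.AdditiveKoly.SplitCompletion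
  Summit.BirchSwinnertonDyer.BirchSwinnertonDyer.Theorems.KellerYinLemma511NonsplitOfPrint
open Literature.NumberTheory.EllipticCurves.CastellaGrossiLeeSkinner2022
  (cor126_residualCharacter_globalLift cor126_residualCharacter_localSurjective
    prop125_characterGrSelmerDual_torsion_muZero_dim)

/-! ### §1 Both local clauses at every prime above a non-split multiplicative `p`, for ANY line of `E[p]` -/

/-- **At a NON-SPLIT multiplicative odd prime, no subgroup of order `p` of `E[p](ℚ̄)` is fixed pointwise by a decomposition group
above `p`, and none has a quotient on which it acts trivially** — for EVERY prime `𝔓 ∣ p` of `\bar ℤ` and EVERY `Φ ≤ E[p]` with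
`#Φ = p` (no stability assumed). The Tate-curve lemma at the chosen prime `𝔓₀` (`X2.TateLineDecomposition`, both graded characters
are `ωχ`, `χ` with `χ` the non-trivial unramified quadratic character) applied to the line `σ⁻¹Φ` when `𝔓 = σ𝔓₀`.
[cite: SilvermanATAEC1994, Ch. V Thm. 5.3, Cor. 5.4] [cite: NeukirchANT1999, Ch. I §9 (9.6)] -/
theorem not_fix_and_not_quot_of_not_split_of_card_eq
    (W : WeierstrassCurve ℚ) [W.IsElliptic] [W.IsGloballyMinimal] (p : ℕ) [Fact p.Prime]
    (hp2 : p ≠ 2) (hmult : W.HasMultiplicativeReductionAtPrime p)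
    (hns : ¬ W.HasSplitMultiplicativeReductionAtPrime p)
    {v : HeightOneSpectrum (𝓞 ℚ)} (hpv : ((p : ℕ) : 𝓞 ℚ) ∈ v.asIdeal)
    {Φ : AddSubgroup (geomTorsion W (p : ℤ))} (hΦ : Nat.card Φ = p)
    {𝔓 : Ideal (absIntegers (𝓞 ℚ) ℚ)} (h𝔓 : 𝔓 ∈ v.primesAbove) :
    (¬ ∀ g ∈ 𝔓.decompositionSubgroup (absoluteGaloisGroup ℚ), ∀ P ∈ Φ, g • P = P) ∧
      (¬ ∀ g ∈ 𝔓.decompositionSubgroup (absoluteGaloisGroup ℚ),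
        ∀ P : geomTorsion W (p : ℤ), g • P - P ∈ Φ) := by
  -- `𝔓 = σ • 𝔓₀` with `𝔓₀` the chosen prime above `v`, `D_{𝔓₀} = decomp v`
  obtain ⟨σ, hσ⟩ := IsDedekindDomain.HeightOneSpectrum.exists_smul_eq_of_mem_primesAbove_holds
    (adicCompletionPrime_mem_primesAbove ℚ v) h𝔓
  have hconj : ∀ g ∈ decomp (K := ℚ) v,
      σ * g * σ⁻¹ ∈ 𝔓.decompositionSubgroup (absoluteGaloisGroup ℚ) := by
    intro g hg
    have hg' : g ∈ (adicCompletionPrime ℚ v).decompositionSubgroup (absoluteGaloisGroup ℚ) := by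
      rw [decompositionSubgroup_adicCompletionPrime_eq_range]; exact hg
    rw [← hσ, Ideal.decompositionSubgroup_smul]
    have := Subgroup.smul_mem_pointwise_smul g (MulAut.conj σ) _ hg'
    simpa only [MulAut.smul_def, MulAut.conj_apply] using this
  -- the conjugated line `Φ' = σ⁻¹ Φ`, of order `p`, and the Tate-curve lemma for it at the chosen prime
  let f := DistribSMul.toAddMonoidHom (geomTorsion W (p : ℤ)) σ⁻¹
  have hΦ' : Nat.card (Φ.map f) = p := ResidualLineRigidity.natCard_map_eq σ⁻¹ hΦ
  obtain ⟨h1, h2⟩ :=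
    Summit.BirchSwinnertonDyer.Rank1Residual.X2.TateLineDecomposition.not_fix_and_not_quot_of_not_split W p
    TateCurve.Silverman1994_thmV53_corV54_tateUniformisation_holds hp2 hmult hns hpv hΦ'
  refine ⟨fun h ↦ h1 fun g hg P' hP' ↦ ?_, fun h ↦ h2 fun g hg P' ↦ ?_⟩
  · -- `P' = σ⁻¹ • P` with `P ∈ Φ`; `g • (σ⁻¹ • P) = σ⁻¹ • ((σ g σ⁻¹) • P) = σ⁻¹ • P`
    obtain ⟨P, hP, rfl⟩ := AddSubgroup.mem_map.mp hP'
    have h' := h _ (hconj g hg) P hP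
    change g • (σ⁻¹ • P) = σ⁻¹ • P
    rw [mul_smul, mul_smul] at h'
    have h'' := congrArg (σ⁻¹ • ·) h'
    simpa only [inv_smul_smul] using h''
  · -- `(σ g σ⁻¹) • (σ • P') - σ • P' = σ • (g • P' - P') ∈ Φ`, so `g • P' - P' ∈ σ⁻¹ Φ`
    have h' := h _ (hconj g hg) (σ • P')
    rw [mul_smul, mul_smul, inv_smul_smul, ← smul_sub] at h'
    exact AddSubgroup.mem_map.mpr ⟨σ • (g • P' - P'), h', by
      change σ⁻¹ • (σ • (g • P' - P')) = g • P' - P'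
      rw [inv_smul_smul]⟩

/-! ### §2 The local data at `v̄` of ANY `Γ_K`-stable line of `E_K[p]` at a non-split multiplicative prime -/

/-- **Every `Γ_K`-stable line of `E_K[p]` at a NON-SPLIT multiplicative odd prime carries the CGLS local data at `v̄`**
(`K` imaginary quadratic, `(p)` split, `v̄ ∋ p`, any `ℤ_p`-extension `κ`; `S ≤ E_K[p]` any `Γ_K`-stable subgroup of order `p`):
`#(E_K[p]/S) = p`; `D_{v̄}` fixes neither `S` nor `E_K[p]/S` pointwise; `D_{v̄}` acts on neither through the mod-`p` cyclotomic
character; `E_K[p]/S` has no non-zero `(ker κ ⊓ D_{v̄})`-fixed vector. §1 for the line `t⁻¹(S) ≤ E[p](ℚ̄)` along an equivariant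
`t : E[p](ℚ̄) ≅ E_K[p](K̄)`, CHL's degree-one transport to `D_{v̄}`, the Weil pairing (`det = ω`) for the cyclotomic clauses.
[cite: CastellaGrossiLeeSkinner2022, §1.2 (hypothesis θ|_{G_v̄} ≠ 𝟙, ω), §1.4] [cite: SilvermanATAEC1994, Ch. V Thm. 5.3, Cor. 5.4] -/
theorem localData_of_not_split
    {p : ℕ} [hp : Fact p.Prime] (W : WeierstrassCurve ℚ) [W.IsElliptic] [W.IsGloballyMinimal]
    (K : Type) [Field K] [NumberField K] (vbar : HeightOneSpectrum (𝓞 K)) (κ : ZpExtension K p)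
    (hp2 : 2 < p) (hmult : Mult W p) (hns : ¬ W.HasSplitMultiplicativeReductionAtPrime p)
    (hK : IsImaginaryQuadratic K)
    (hsplit : ((Ideal.span {(p : ℤ)}).primesOver (𝓞 K)).ncard = 2)
    (hvbar : ((p : ℕ) : 𝓞 K) ∈ vbar.asIdeal)
    (S : StableSubgroup (absoluteGaloisGroup K) ((W.baseChange K).geomTorsion ((p : ℕ) : ℤ)))
    (hSub : Nat.card S.Sub = p) :
    Nat.card S.Quot = p ∧
      (¬ ∀ g ∈ decomp vbar, ∀ x : S.Sub, g • x = x) ∧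
      (¬ ∀ g ∈ decomp vbar, ∀ y : S.Quot, g • y = y) ∧
      (¬ ∀ g ∈ decomp vbar, ∀ m : S.Sub,
        g • m = ((modNCyclotomicCharacter K p g : (ZMod p)ˣ) : ZMod p).val • m) ∧
      (¬ ∀ g ∈ decomp vbar, ∀ m : S.Quot,
        g • m = ((modNCyclotomicCharacter K p g : (ZMod p)ˣ) : ZMod p).val • m) ∧
      (∀ y : S.Quot, (∀ g : ↥(κ.kerSubgroup ⊓ decomp vbar), g • y = y) → y = 0) := by
  have hpp : p.Prime := hp.out
  have hp2' : p ≠ 2 := by omega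
  haveI hEK : (W.baseChange K).IsElliptic := inferInstanceAs (W.map (algebraMap ℚ K)).IsElliptic
  haveI : IsGalois ℚ K := isGalois_of_finrank_eq_two K hK.1
  have he : vbar.asIdeal.ramificationIdx (𝓞 ℚ) = 1 :=
    ramificationIdx_eq_one_of_card_primesOver K p hK.1 hsplit vbar hvbar
  have hf : vbar.asIdeal.inertiaDeg (𝓞 ℚ) = 1 :=
    inertiaDeg_eq_one_of_card_primesOver K p hK.1 hsplit vbar hvbar
  set v : HeightOneSpectrum (𝓞 ℚ) := vbar.under (𝓞 ℚ) with hv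
  have hw : vbar.asIdeal.under (𝓞 ℚ) = v.asIdeal := by rw [hv, HeightOneSpectrum.under_asIdeal]
  have hpv : ((p : ℕ) : 𝓞 ℚ) ∈ v.asIdeal := natCast_mem_under K p vbar hvbar
  -- the line `Φ = t⁻¹(S)` over `ℚ̄`
  obtain ⟨t, ht⟩ := exists_geomTorsion_baseChange_equiv W K ((p : ℕ) : ℤ)
  have ht' : ∀ (σ : absoluteGaloisGroup K) (P : W.geomTorsion ((p : ℕ) : ℤ)),
      t (absGaloisRestrict ℚ K σ • P) = σ • t P := fun σ P ↦ by
    rw [← resGal_eq_absGaloisRestrict]; exact ht σ P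
  let Φ : AddSubgroup (W.geomTorsion ((p : ℕ) : ℤ)) := S.toAddSubgroup.comap t.toAddMonoidHom
  have hS : ∀ Q : (W.baseChange K).geomTorsion ((p : ℕ) : ℤ), Q ∈ S.toAddSubgroup ↔ t.symm Q ∈ Φ := fun Q ↦ by
    change Q ∈ S.toAddSubgroup ↔ t (t.symm Q) ∈ S.toAddSubgroup
    rw [t.apply_symm_apply]
  have hΦcard : Nat.card Φ = p := by
    have e : Φ ≃ S.toAddSubgroup :=
      { toFun := fun x ↦ ⟨t x.1, x.2⟩
        invFun := fun y ↦ ⟨t.symm y.1, by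
          change t (t.symm y.1) ∈ S.toAddSubgroup
          rw [t.apply_symm_apply]; exact y.2⟩
        left_inv := fun x ↦ Subtype.ext (t.symm_apply_apply x.1)
        right_inv := fun y ↦ Subtype.ext (t.apply_symm_apply y.1) }
    have h : Nat.card Φ = Nat.card S.Sub := Nat.card_congr e
    exact h.trans hSub
  have hcell : ∀ 𝔓 ∈ v.primesAbove,
      (¬ ∀ g ∈ 𝔓.decompositionSubgroup (absoluteGaloisGroup ℚ), ∀ P ∈ Φ, g • P = P) ∧
        (¬ ∀ g ∈ 𝔓.decompositionSubgroup (absoluteGaloisGroup ℚ),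
          ∀ P : geomTorsion W (p : ℤ), g • P - P ∈ Φ) :=
    fun 𝔓 h𝔓 ↦ not_fix_and_not_quot_of_not_split_of_card_eq W p hp2' hmult hns hpv hΦcard h𝔓
  have hEp : Nat.card ((W.baseChange K).geomTorsion ((p : ℕ) : ℤ)) = p ^ 2 :=
    (W.baseChange K).natCard_geomTorsion_prime_eq_sq hpp
  have hQuot : Nat.card S.Quot = p := by
    have h := S.natCard_eq_mul
    rw [hEp, hSub, sq] at h
    exact (Nat.eq_of_mul_eq_mul_right hpp.pos h).symm
  have hnon1 : ¬ ∀ γ ∈ decomp vbar, ∀ x : S.Sub, γ • x = x :=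
    not_forall_decomp_smul_sub_eq_of_corr Φ t ht' S hS
      (not_forall_decomp_smul_eq K Φ hw he hf fun 𝔓 h𝔓 ↦ (hcell 𝔓 h𝔓).1)
  have hnon2 : ¬ ∀ γ ∈ decomp vbar, ∀ y : S.Quot, γ • y = y :=
    not_forall_decomp_smul_quot_eq_of_corr Φ t ht' S hS
      (not_forall_decomp_smul_sub_mem K Φ hw he hf fun 𝔓 h𝔓 ↦ (hcell 𝔓 h𝔓).2)
  refine ⟨hQuot, hnon1, hnon2, not_forall_smul_sub_eq_cyclotomic (W.baseChange K) p S hSub (decomp vbar) hnon2,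
    not_forall_smul_quot_eq_cyclotomic (W.baseChange K) p S hSub (decomp vbar) hnon1,
    eq_zero_of_fixed_of_not_forall_decomp_smul_eq κ vbar hQuot hnon2⟩

/-! ### §3 Keller–Yin Thm. 1.4.1's λ-relation for EVERY residual pair at a non-split multiplicative Eisenstein datum -/

/-- **At every NON-SPLIT multiplicative Eisenstein datum and EVERY residual pair `(θsub, θquot)` of `E_K[p]`: CGLS22 Prop. 1.2.5 +
Cor. 1.2.6 [PUBLISHED] ⟹ `p^{λ(𝔛^{Sf}_f)} · #𝔛^{Sf}_f[p] = p^{λ(𝔛_sub) + λ(𝔛_quot)}`, `λ(𝔛^{Sf}_f) ≤ λ(𝔛_sub) + λ(𝔛_quot)`, and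
`=` if `𝔛^{Sf}_f` has no `p`-torsion.** Binders: `W/ℚ` globally minimal, `2 < p`, `p ‖ N` NON-split, `K` imaginary quadratic with the
Heegner hypothesis for `N_E` and `(p)` split, `v̄ ∋ p` the strict place, `κ` anticyclotomic with topological generator `γ`, `Sf` = the
places of `K` over `N_E` off `p`; `𝔛^{Sf}_f = AcSelmer.XAc E_K p κ v̄ ↑Sf γ`; `𝔛_sub = Dsub.X`, `𝔛_quot = Dquot.X` ANY strict dual data
(`KellerYin2024.GrDualData`) of `(F/𝒪)(θsub)`, `(F/𝒪)(θquot)` — CGLS's `𝔛^S_φ`, `𝔛^S_ψ`. The four local hypotheses of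
`lambdaInvariant_le_add_of_isResidualPairOver` are DISCHARGED by §2 (the residual pair's line is `Γ_K`-stable of order `p`). This is
Keller–Yin Thm. 1.4.1's `λ(𝔛^S_f) = λ(𝔛^S_φ) + λ(𝔛^S_ψ)` at `p ‖ N` non-split («whose proof still works in the multiplicative reduction
setting», KY §5.1) in the kernel as `≤` modulo PUBLISHED character-level facts only, and as `=` modulo the same plus the ONE
E-level input «`𝔛^{Sf}_f` has no non-zero finite `Λ`-submodule» (CGLS Cor. 1.4.3), kept as a hypothesis.
[cite: KellerYin2024, Thm. 1.4.1, Lemma 5.1.1 and §5.1 (arXiv:2402.12781v2 TeX L1087–1098, L1744–1778)]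
[cite: CastellaGrossiLeeSkinner2022, §1.2 Prop. 1.2.5, Cor. 1.2.6, §1.4 Props. 1.4.1–1.4.2, Cor. 1.4.3 (e-print TeX L681–905)]
[cite: SilvermanATAEC1994, Ch. V Thm. 5.3, Cor. 5.4] -/
theorem lambdaInvariant_le_add_of_isResidualPairOver_of_not_split
    (hprop125 : prop125_characterGrSelmerDual_torsion_muZero_dim)
    (hlift : cor126_residualCharacter_globalLift) (hlocal : cor126_residualCharacter_localSurjective)
    {p : ℕ} [hp : Fact p.Prime] (W : WeierstrassCurve ℚ) [W.IsElliptic] [W.IsGloballyMinimal]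
    (K : Type) [Field K] [NumberField K] (vbar : HeightOneSpectrum (𝓞 K))
    (κ : ZpExtension K p) (γ : absoluteGaloisGroup K) [Fact (κ.IsTopGenerator γ)]
    (Sf : Finset (HeightOneSpectrum (𝓞 K)))
    (hp2 : 2 < p) (hmult : Mult W p) (hns : ¬ W.HasSplitMultiplicativeReductionAtPrime p)
    (hK : IsImaginaryQuadratic K) (hH : SatisfiesHeegnerHypothesis (W.conductorNorm ℤ) K)
    (hsplit : ((Ideal.span {(p : ℤ)}).primesOver (𝓞 K)).ncard = 2)
    (hvbar : ((p : ℕ) : 𝓞 K) ∈ vbar.asIdeal) (hκ : κ.IsAnticyclotomic)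
    (hSf : ∀ w : HeightOneSpectrum (𝓞 K), w ∈ Sf ↔
      (((W.conductorNorm ℤ : ℤ) : 𝓞 K) ∈ w.asIdeal ∧ ((p : ℕ) : 𝓞 K) ∉ w.asIdeal))
    (θsub θquot : FramedGaloisRep K (padicCoeffIntegers (∅ : Set (PadicAlgCl p))) 1)
    (hpair : IsResidualPairOver (W.baseChange K) p θsub θquot)
    (Dsub : GrDualData κ (charModule (∅ : Set (PadicAlgCl p)) θsub) vbar (↑Sf : Set (HeightOneSpectrum (𝓞 K))) γ)
    (Dquot : GrDualData κ (charModule (∅ : Set (PadicAlgCl p)) θquot) vbar (↑Sf : Set (HeightOneSpectrum (𝓞 K))) γ) :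
    p ^ lambdaInvariant p (XAc (W.baseChange K) p κ vbar (↑Sf : Set (HeightOneSpectrum (𝓞 K))) γ) *
          Nat.card {x : XAc (W.baseChange K) p κ vbar (↑Sf : Set (HeightOneSpectrum (𝓞 K))) γ // p • x = 0} =
        p ^ (lambdaInvariant p Dsub.X + lambdaInvariant p Dquot.X) ∧
      lambdaInvariant p (XAc (W.baseChange K) p κ vbar (↑Sf : Set (HeightOneSpectrum (𝓞 K))) γ) ≤
        lambdaInvariant p Dsub.X + lambdaInvariant p Dquot.X ∧
      ((∀ x : XAc (W.baseChange K) p κ vbar (↑Sf : Set (HeightOneSpectrum (𝓞 K))) γ, p • x = 0 → x = 0) →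
        lambdaInvariant p (XAc (W.baseChange K) p κ vbar (↑Sf : Set (HeightOneSpectrum (𝓞 K))) γ) =
          lambdaInvariant p Dsub.X + lambdaInvariant p Dquot.X) := by
  haveI hEK : (W.baseChange K).IsElliptic := inferInstanceAs (W.map (algebraMap ℚ K)).IsElliptic
  -- the residual pair's line and its local data at `v̄`
  obtain ⟨S, hSub, -, ⟨jsub, hjsub, hjsub_inj, hjsub_range⟩, ⟨jquot, hjquot, hjquot_inj, hjquot_range⟩⟩ :=
    ResidualPairStableLine.exists_stableLine_of_isResidualPairOver (W.baseChange K) hpair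
  obtain ⟨-, hnon1, hnon2, hωS, hωQ, -⟩ := localData_of_not_split W K vbar κ hp2 hmult hns hK hsplit hvbar S hSub
  -- in the currency of the character modules
  have hne1sub := fun h ↦ hnon1 ((forall_smul_eq_iff_of_embedding θsub jsub hjsub hjsub_inj hjsub_range (decomp vbar)).mpr h)
  have hne1quot := fun h ↦ hnon2 ((forall_smul_eq_iff_of_embedding θquot jquot hjquot hjquot_inj hjquot_range (decomp vbar)).mpr h)
  have hneωsub := fun h ↦
    hωS ((forall_smul_eq_cyclotomic_iff_of_embedding θsub jsub hjsub hjsub_inj hjsub_range (decomp vbar)).mpr h)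
  have hneωquot := fun h ↦
    hωQ ((forall_smul_eq_cyclotomic_iff_of_embedding θquot jquot hjquot hjquot_inj hjquot_range (decomp vbar)).mpr h)
  exact lambdaInvariant_le_add_of_isResidualPairOver hprop125 hlift hlocal W K vbar κ γ Sf hp2 hK hH hsplit hvbar hκ hSf θsub θquot
    hpair hne1sub hneωsub hne1quot hneωquot Dsub Dquot

end Summit.BirchSwinnertonDyer.BirchSwinnertonDyer.Theorems.ResidualDevissageNonsplitLambdaIdentityAtNonsplit

end
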